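import Literature.AlgebraicGeometry.ModuliOfAbelianVarieties.SiegelCanonicalModelUnique
import Literature.AlgebraicGeometry.ModuliOfAbelianVarieties.SiegelHeckeOrbitDensity
import Literature.AlgebraicGeometry.ModuliOfAbelianVarieties.SiegelCMSpecialPairExistsSqrt
import Mathlib.NumberTheory.Real.Irrational
import HarnessLib

/-!
# The canonical `ℚ`-model of the Siegel tower is UNIQUE — hypothesis-free form
# ([Deligne1971TravauxShimura] Cor. 5.5 with 5.1–5.2, Lemme 5.10.1; [Milne2005ShimuraVarieties] Thm. 13.7 (a) for `(GSp_δ, S^±)`)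

Topic `AlgebraicGeometry/ModuliOfAbelianVarieties`; namespace `Literature.AlgebraicGeometry.ModuliOfAbelianVarieties`.
THEOREMS ONLY (no definition, no named fact, no instance, no `sorry`; net debt 0).  Cell hodgecm-mathlib, #60 road (A-p05 g7 table
v1.16/v1.17, node **R60-29b**; director g6 RULING s86 (2)(b) banked generic leaf).  Discharges the two honest hypotheses of ★ R60-29
`SiegelRationalModel.existsUnique_iso_of_isCanonical` by name:
* (D2) CM density = ★ R60-32 `SiegelComplexRecordSystem.dense_range_pts_symm_mk` ([Milne2005ShimuraVarieties] Lemma 13.5);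
* (D1) Deligne's supply = the TWO field-pinned CM special pairs of ★ R60-16b (`CMStructure.exists_isSpecial_cyclotomicField_four` over
  `ℚ(ζ₄)`, `…_three` over `ℚ(ζ₃)`), whose reflex data are bounded by `ℚ(i)` and `ℚ(i√3)` (§1: for a quadratic `M = ℚ(w)` and a CM type
  `Φ ⊆ {ρ | ρ w = z}` one has `E*(Φ) = traceField Φ ≤ ℚ(z)`), and `ℚ(i) ∩ ℚ(i√3) = ℚ` inside `ℂ` (§2: `√3 ∉ ℚ`) — [Deligne1971TravauxShimura]
  5.1–5.2 («points spéciaux … linéairement disjoints»).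
HEAD (§3) **`SiegelRationalModel.existsUnique_iso_of_isCanonical'`**: for `g ≥ 1` and a polarisation type with `δᵢ ≥ 1`, two CANONICAL
`ℚ`-models `R`, `R′` of one Siegel complex record system are related by a UNIQUE isomorphism of towers compatible with `e`, `e′` —
[Deligne1971TravauxShimura] Cor. 5.5 / [Milne2005ShimuraVarieties] Thm. 13.7 (a) as a THEOREM of the tree's (σ3)/(σ4) carriers, no residual
hypothesis.  (Locator note, lit1 D-CITE 18:45Z: the uniqueness of (weakly) canonical models is Corollaire 5.5 p. 156 of
[Deligne1971TravauxShimura]; its 3.15 p. 143 defines the special points.)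
Nothing printed is asserted.  HC_CM is proved only modulo the 7 printed citations until rung 0 closes.

## References
* [Deligne1971TravauxShimura] P. Deligne, *Travaux de Shimura*, Sém. Bourbaki 389 (1971): 3.15 p. 143 (points spéciaux); 5.1–5.2 p. 155;
  Cor. 5.5 p. 156 (unicité); Lemme 5.10.1 p. 158.
* [Milne2005ShimuraVarieties] J. S. Milne, *Introduction to Shimura varieties* (2005): Ex. 12.4 (b) p. 112; Lemma 13.5 p. 118; Thm. 13.7 p. 119.
* [Lang2002] S. Lang, *Algebra* (2002), Ch. V §1 (finite extensions, degree), Ch. VIII §1.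
-/

set_option autoImplicit false

noncomputable section

open Matrix NumberField Polynomial CategoryTheory

namespace Literature.AlgebraicGeometry.ModuliOfAbelianVarieties

open Literature.AlgebraicGeometry.Motives (CMType)
open Literature.NumberTheory.ComplexMultiplication (traceField cmTypeTrace cmTypeTrace_apply)
open IntermediateField

variable {g : ℕ}

/-! ### §1. Reflex data of a quadratic CM field: `E*(Φ) ≤ ℚ(z)` when every `ρ ∈ Φ` sends `w ↦ z` -/

section Quadratic

variable {M : Type} [Field M] [NumberField M]

/-- In the `ℚ`-basis `(1, w)` of a quadratic field, `x = a + b·w`. [cite: Lang2002, Ch. V §1 Prop. 1.4]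
[cite: Milne2005ShimuraVarieties, Ex. 12.4 (b) p. 112] -/
theorem eq_repr_add_repr_mul_of_basis_pair (bw : Module.Basis (Fin 2) ℚ M) {w : M} (h0 : bw 0 = 1) (h1 : bw 1 = w) (x : M) :
    x = algebraMap ℚ M (bw.repr x 0) + algebraMap ℚ M (bw.repr x 1) * w := by
  have h := bw.sum_repr x
  rw [Fin.sum_univ_two, h0, h1, Algebra.smul_def, mul_one, Algebra.smul_def] at h
  exact h.symm

/-- **The reflex field of a CM type of a quadratic field lies in `ℚ(z)`, `z = ρ(w)`**: if `M = ℚ(w)` is quadratic (with `ℚ`-basis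
`(1, w)`) and every `ρ ∈ Φ` sends `w ↦ z`, then every type trace `Σ_{ρ∈Φ} ρ(x) = Σ (a + b·z)` lies in `ℚ⟮z⟯`, so
`traceField Φ ≤ ℚ⟮z⟯` ([Milne2005ShimuraVarieties] Ex. 12.4 (b): for an imaginary quadratic field the reflex field is the field itself).
[cite: Milne2005ShimuraVarieties, Ex. 12.4 (b) p. 112] [cite: Shimura1998, §8.3 Prop. 28] -/
theorem traceField_le_adjoin_simple_of_forall_apply_eq (bw : Module.Basis (Fin 2) ℚ M) {w : M} (h0 : bw 0 = 1) (h1 : bw 1 = w)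
    (Φ : CMType M) (z : ℂ) (hΦ : ∀ ρ ∈ Φ.1, ρ w = z) : traceField Φ ≤ ℚ⟮z⟯ := by
  rw [traceField, IntermediateField.adjoin_le_iff]
  rintro _ ⟨x, rfl⟩
  rw [cmTypeTrace_apply]
  refine IntermediateField.sum_mem _ fun ρ hρ => ?_
  have hρw : ρ w = z := hΦ ρ ((Set.Finite.mem_toFinset _).1 hρ)
  have hρq : ∀ q : ℚ, ρ (algebraMap ℚ M q) = algebraMap ℚ ℂ q := fun q =>
    RingHom.congr_fun (Subsingleton.elim (ρ.comp (algebraMap ℚ M)) (algebraMap ℚ ℂ)) q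
  rw [eq_repr_add_repr_mul_of_basis_pair bw h0 h1 x, map_add, map_mul, hρq, hρq, hρw]
  exact add_mem (IntermediateField.algebraMap_mem _ _)
    (mul_mem (IntermediateField.algebraMap_mem _ _) (IntermediateField.mem_adjoin_simple_self ℚ z))

end Quadratic

/-! ### §2. `ℚ(i) ∩ ℚ(i√3) = ℚ` inside `ℂ` ([Deligne1971TravauxShimura] 5.1–5.2: two special points with linearly disjoint reflex fields) -/

section Disjoint

/-- An element `z ∈ ℂ` with `z² ∈ ℚ` is integral over `ℚ` (root of `X² - q`), so `ℚ⟮z⟯` is finite over `ℚ`. [cite: Lang2002, Ch. V §1 Prop. 1.4] -/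
theorem isIntegral_of_sq_eq_algebraMap {z : ℂ} {q : ℚ} (hz : z ^ 2 = algebraMap ℚ ℂ q) : IsIntegral ℚ z :=
  IsIntegral.of_pow two_pos (hz ▸ isIntegral_algebraMap)

/-- `ℚ⟮z⟯` is finite-dimensional over `ℚ` for `z² ∈ ℚ`. [cite: Lang2002, Ch. V §1 Prop. 1.4] -/
theorem finiteDimensional_adjoin_simple_of_sq_eq_algebraMap {z : ℂ} {q : ℚ} (hz : z ^ 2 = algebraMap ℚ ℂ q) :
    FiniteDimensional ℚ ℚ⟮z⟯ :=
  IntermediateField.adjoin.finiteDimensional (isIntegral_of_sq_eq_algebraMap hz)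

/-- **Elements of `ℚ⟮z⟯`, `z² = q ∈ ℚ`, are `a + b·z` with `a, b ∈ ℚ`** (divide a representing polynomial by the monic `X² - q`).
[cite: Lang2002, Ch. V §1 Prop. 1.4] -/
theorem exists_eq_add_mul_of_mem_adjoin_simple_of_sq {z : ℂ} {q : ℚ} (hz : z ^ 2 = algebraMap ℚ ℂ q) {x : ℂ} (hx : x ∈ ℚ⟮z⟯) :
    ∃ a b : ℚ, x = algebraMap ℚ ℂ a + algebraMap ℚ ℂ b * z := by
  have hint : IsIntegral ℚ z := isIntegral_of_sq_eq_algebraMap hz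
  have hx' : x ∈ (ℚ⟮z⟯).toSubalgebra := hx
  rw [IntermediateField.adjoin_simple_toSubalgebra_of_isAlgebraic hint.isAlgebraic,
    Algebra.adjoin_singleton_eq_range_aeval] at hx'
  obtain ⟨p, rfl⟩ := hx'
  -- divide `p` by the monic `X² - q`
  have hmonic : (X ^ 2 - C q : ℚ[X]).Monic := monic_X_pow_sub_C q two_ne_zero
  have hroot : aeval z (X ^ 2 - C q : ℚ[X]) = 0 := by
    rw [map_sub, map_pow, aeval_X, aeval_C, hz, sub_self]
  have hdiv := modByMonic_add_div p (X ^ 2 - C q : ℚ[X])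
  have hdeg : (p %ₘ (X ^ 2 - C q)).degree ≤ 1 := by
    have h := degree_modByMonic_lt p hmonic
    rw [degree_X_pow_sub_C two_pos] at h
    exact Order.le_of_lt_succ (by exact_mod_cast h)
  have hr := eq_X_add_C_of_degree_le_one hdeg
  refine ⟨(p %ₘ (X ^ 2 - C q)).coeff 0, (p %ₘ (X ^ 2 - C q)).coeff 1, ?_⟩
  change aeval z p = _
  conv_lhs => rw [← hdiv, map_add, map_mul, hroot, zero_mul, add_zero, hr]
  rw [map_add, map_mul, aeval_C, aeval_X, aeval_C]
  ring

/-- `(i√3)² = -3`. [cite: Milne2005ShimuraVarieties, Ex. 12.4 (b) p. 112] -/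
theorem I_mul_sqrt_three_sq :
    (Complex.I * (Real.sqrt ((3 : ℚ) : ℝ) : ℂ)) ^ 2 = algebraMap ℚ ℂ (-3) := by
  have h3 : ((Real.sqrt ((3 : ℚ) : ℝ) : ℂ)) ^ 2 = 3 := by
    rw [← Complex.ofReal_pow, Real.sq_sqrt (by positivity)]
    push_cast
    rfl
  rw [mul_pow, Complex.I_sq, h3, map_neg, map_ofNat]
  ring

/-- `i² = -1` in the `algebraMap ℚ ℂ` spelling. [cite: Milne2005ShimuraVarieties, Ex. 12.4 (b) p. 112] -/
theorem I_sq_eq_algebraMap : (Complex.I) ^ 2 = algebraMap ℚ ℂ (-1) := by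
  rw [Complex.I_sq, map_neg, map_one]

/-- **`ℚ(i) ∩ ℚ(i√3) = ℚ` in `ℂ`** ([Deligne1971TravauxShimura] 5.1–5.2: the reflex fields of the two CM special pairs over `ℚ(ζ₄)` and
`ℚ(ζ₃)` are linearly disjoint): an element of both is `a + b·i = a′ + b′·i√3` with rational coefficients; comparing real and imaginary
parts, `b′ ≠ 0` would make `√3 = b/b′` rational ([Lang2002] — `√3 ∉ ℚ`, Mathlib `Nat.Prime.irrational_sqrt`), so `b′ = 0` and the
element is rational. [cite: Deligne1971TravauxShimura, 5.1–5.2 p. 155] [cite: Lang2002, Ch. V §1] -/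
theorem adjoin_I_inf_adjoin_I_mul_sqrt_three_eq_bot :
    ℚ⟮Complex.I⟯ ⊓ ℚ⟮Complex.I * (Real.sqrt ((3 : ℚ) : ℝ) : ℂ)⟯ = (⊥ : IntermediateField ℚ ℂ) := by
  refine le_bot_iff.1 fun x hx => ?_
  obtain ⟨a, b, hab⟩ := exists_eq_add_mul_of_mem_adjoin_simple_of_sq I_sq_eq_algebraMap hx.1
  obtain ⟨a', b', hab'⟩ := exists_eq_add_mul_of_mem_adjoin_simple_of_sq I_mul_sqrt_three_sq hx.2
  have h33 : ((3 : ℚ) : ℝ) = 3 := by norm_num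
  -- real and imaginary parts of the two presentations
  have him : (b : ℝ) = (b' : ℝ) * Real.sqrt 3 := by
    have h := congrArg Complex.im (hab.symm.trans hab')
    simp only [Complex.add_im, Complex.mul_im, eq_ratCast, Complex.ratCast_re, Complex.ratCast_im, Complex.I_re, Complex.I_im,
      Complex.mul_re, Complex.ofReal_re, Complex.ofReal_im, mul_zero, zero_mul, sub_zero, add_zero, zero_add, mul_one, one_mul,
      h33] at h
    exact h
  have hre : (a : ℝ) = (a' : ℝ) := by
    have h := congrArg Complex.re (hab.symm.trans hab')
    simp only [Complex.add_re, Complex.mul_re, eq_ratCast, Complex.ratCast_re, Complex.ratCast_im, Complex.I_re, Complex.I_im,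
      Complex.mul_im, Complex.ofReal_re, Complex.ofReal_im, mul_zero, zero_mul, add_zero, sub_self, mul_one, h33] at h
    exact h
  by_cases hb' : b' = 0
  · -- `x = a'` is rational
    rw [IntermediateField.mem_bot]
    refine ⟨a', ?_⟩
    rw [hab', hb', map_zero, zero_mul, add_zero]
  · -- `√3 = b / b'` would be rational
    exfalso
    have hirr : Irrational (Real.sqrt ((3 : ℕ) : ℝ)) := Nat.Prime.irrational_sqrt Nat.prime_three
    rw [Nat.cast_ofNat] at hirr
    have hsq : Real.sqrt 3 = ((b / b' : ℚ) : ℝ) := by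
      rw [Rat.cast_div, him]
      field_simp
    exact hirr.ne_rat (b / b') hsq

end Disjoint

/-! ### §3. HEAD — [Deligne 1971] Cor. 5.5 / [Milne ISV] Thm. 13.7 (a) for the Siegel tower, no residual hypothesis -/

open Literature.AlgebraicGeometry.Motives in
/-- **UNIQUENESS OF THE CANONICAL `ℚ`-MODEL OF THE SIEGEL TOWER** ([Deligne1971TravauxShimura] Cor. 5.5 p. 156 «unicité» with 5.1–5.2 and Lemme
5.10.1; [Milne2005ShimuraVarieties] Thm. 13.7 (a) p. 119 «A canonical model of `Sh_K(G,X)` (if it exists) is unique up to a unique isomorphism»,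
for `(G, X) = (GSp_δ, S^±)`, `E(G,X) = ℚ`): for `g ≥ 1`, a polarisation type `δ` with every `δᵢ ≥ 1`, a Siegel complex record system `Sg`
and two `ℚ`-models `R, R′ : SiegelRationalModel g δ Sg` that are both CANONICAL (`IsCanonical`: reciprocity (62) at every CM special
pair of [Deligne1971TravauxShimura] 4.18), there is a UNIQUE isomorphism of towers `φ : R.Nm ≅ R′.Nm` over `ℚ` with
`φ_L ⊗_ℚ ℂ ≫ e′_L = e_L` at every principal level.  PROOF: ★ R60-29 `existsUnique_iso_of_isCanonical` with its two inputs DISCHARGED —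
(D2) density of the Hecke orbits = ★ R60-32 `SiegelComplexRecordSystem.dense_range_pts_symm_mk`; (D1) the two CM special pairs of ★ R60-16b
over `ℚ(ζ₄)` and `ℚ(ζ₃)` (`CMStructure.exists_isSpecial_cyclotomicField_four/_three`), with reflex-field bounds `ℚ⟮i⟯`, `ℚ⟮i√3⟯` (§1) meeting
in `⊥` (§2).  No residual hypothesis: the statement is a theorem of the tree's (σ3)/(σ4) carriers. [cite: Deligne1971TravauxShimura, Cor. 5.5
p. 156; 5.1–5.2 p. 155; Lemme 5.10.1 p. 158; 4.18 p. 150] [cite: Milne2005ShimuraVarieties, Thm. 13.7 (a) p. 119; Lemma 13.5 p. 118; Ex. 12.4 (b) p. 112] -/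
theorem SiegelRationalModel.existsUnique_iso_of_isCanonical' {δ : Fin g → ℕ} (hg : 0 < g) (hδ : ∀ i, 0 < δ i)
    {Sg : SiegelComplexRecordSystem g δ} (R R' : SiegelRationalModel g δ Sg) (hR : R.IsCanonical) (hR' : R'.IsCanonical) :
    ∃! φ : R.Nm ≅ R'.Nm, ∀ L : SiegelLevel δ,
      (Motives.baseChange ℚ ℂ).map (φ.hom.app L) ≫ R'.e.hom.app L = R.e.hom.app L := by
  classical
  -- the two field-pinned special pairs (★ R60-16b)
  obtain ⟨hNF₄, hCM₄, c₄, J₄, Φ₄, ⟨w₄, hw₄, hΦ₄⟩, hsp₄⟩ := CMStructure.exists_isSpecial_cyclotomicField_four δ hδ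
  obtain ⟨hNF₃, hCM₃, c₃, J₃, Φ₃, ⟨w₃, hw₃, hΦ₃⟩, hsp₃⟩ := CMStructure.exists_isSpecial_cyclotomicField_three δ hδ
  -- `ℚ`-bases `(1, w)` of the two quadratic fields (finrank `φ(4) = φ(3) = 2`)
  have hfin₄ : Module.finrank ℚ (CyclotomicField 4 ℚ) = 2 := by
    haveI : NeZero ((4 : ℕ) : ℚ) := ⟨by norm_num⟩
    haveI : IsCyclotomicExtension {4} ℚ (CyclotomicField 4 ℚ) := CyclotomicField.isCyclotomicExtension 4 ℚ
    rw [IsCyclotomicExtension.finrank (n := 4) (CyclotomicField 4 ℚ) (Polynomial.cyclotomic.irreducible_rat (by norm_num))]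
    show Nat.totient (2 ^ 2) = 2 ^ (2 - 1) * (2 - 1)
    exact Nat.totient_prime_pow Nat.prime_two two_pos
  have hfin₃ : Module.finrank ℚ (CyclotomicField 3 ℚ) = 2 := by
    haveI : NeZero ((3 : ℕ) : ℚ) := ⟨by norm_num⟩
    haveI : IsCyclotomicExtension {3} ℚ (CyclotomicField 3 ℚ) := CyclotomicField.isCyclotomicExtension 3 ℚ
    rw [IsCyclotomicExtension.finrank (n := 3) (CyclotomicField 3 ℚ) (Polynomial.cyclotomic.irreducible_rat (by norm_num))]
    exact Nat.totient_prime Nat.prime_three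
  obtain ⟨b₄, h0₄, h1₄⟩ := exists_basis_one_pair (M := CyclotomicField 4 ℚ) hfin₄ hw₄
  have hw₃' : w₃ * w₃ = -algebraMap ℚ (CyclotomicField 3 ℚ) 3 := by rw [map_ofNat]; exact hw₃
  obtain ⟨b₃, h0₃, h1₃⟩ := exists_basis_one_pair_of_mul_self (M := CyclotomicField 3 ℚ) hfin₃ (by norm_num) hw₃'
  -- reflex-field bounds (§1) and their finiteness / disjointness (§2)
  have hE₄ : ∀ i : Fin g, traceField (Φ₄ i) ≤ ℚ⟮Complex.I⟯ := fun i =>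
    traceField_le_adjoin_simple_of_forall_apply_eq b₄ h0₄ h1₄ (Φ₄ i) Complex.I fun ρ hρ => by
      rw [hΦ₄ i] at hρ; exact hρ
  have hE₃ : ∀ i : Fin g, traceField (Φ₃ i) ≤ ℚ⟮Complex.I * (Real.sqrt ((3 : ℚ) : ℝ) : ℂ)⟯ := fun i =>
    traceField_le_adjoin_simple_of_forall_apply_eq b₃ h0₃ h1₃ (Φ₃ i) _ fun ρ hρ => by
      rw [hΦ₃ i] at hρ; exact hρ
  haveI hfd₄ : FiniteDimensional ℚ ℚ⟮Complex.I⟯ := finiteDimensional_adjoin_simple_of_sq_eq_algebraMap I_sq_eq_algebraMap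
  haveI hfd₃ : FiniteDimensional ℚ ℚ⟮Complex.I * (Real.sqrt ((3 : ℚ) : ℝ) : ℂ)⟯ :=
    finiteDimensional_adjoin_simple_of_sq_eq_algebraMap I_mul_sqrt_three_sq
  -- the `Bool`-indexed family for ★ R60-29: `true ↦` the `ℚ(ζ₄)` pair, `false ↦` the `ℚ(ζ₃)` pair; the field of the pair `b` is
  -- `CyclotomicField (cond b 4 3) ℚ` (a UNIFORM type family, so only the Prop-valued `NumberField`/`IsCMField` instances vary)
  have hNF : ∀ b : Bool, NumberField (CyclotomicField (cond b 4 3) ℚ) := fun b => by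
    cases b
    · exact hNF₃
    · exact hNF₄
  have hCM : ∀ b : Bool, IsCMField (CyclotomicField (cond b 4 3) ℚ) := fun b => by
    cases b
    · exact hCM₃
    · exact hCM₄
  have hFD : ∀ b : Bool, FiniteDimensional ℚ
      ↥((fun b : Bool => cond b (ℚ⟮Complex.I⟯) (ℚ⟮Complex.I * (Real.sqrt ((3 : ℚ) : ℝ) : ℂ)⟯)) b) := fun b => by
    cases b
    · exact hfd₃
    · exact hfd₄
  refine @SiegelRationalModel.existsUnique_iso_of_isCanonical g δ Sg R R' hR hR' Bool inferInstance inferInstance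
    (fun _ => Fin g) (fun _ => inferInstance) (fun _ => inferInstance)
    (fun b _ => CyclotomicField (cond b 4 3) ℚ) (fun b _ => inferInstance) (fun b _ => hNF b) (fun b _ => hCM b)
    (fun b => match b with | true => c₄ | false => c₃)
    (fun b => match b with | true => J₄ | false => J₃)
    (fun b => match b with | true => Φ₄ | false => Φ₃)
    (fun b => match b with | true => hsp₄ | false => hsp₃)
    (fun _ => ⟨0, hg⟩)
    (fun b => cond b (ℚ⟮Complex.I⟯) (ℚ⟮Complex.I * (Real.sqrt ((3 : ℚ) : ℝ) : ℂ)⟯)) hFD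
    (fun b => match b with | true => hE₄ | false => hE₃) ?_ ?_
  · -- `ℚ⟮i⟯ ⊓ ℚ⟮i√3⟯ = ⊥`
    rw [iInf_bool_eq]
    exact adjoin_I_inf_adjoin_I_mul_sqrt_three_eq_bot
  · -- density of every Hecke orbit (★ R60-32)
    intro b L
    cases b
    · exact Sg.dense_range_pts_symm_mk hδ L J₃
    · exact Sg.dense_range_pts_symm_mk hδ L J₄

end Literature.AlgebraicGeometry.ModuliOfAbelianVarieties

end
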